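import Literature.NumberTheory.GaloisCohomology.CyclicClassLocalArtinSymbolLocal
import Literature.NumberTheory.GaloisRepresentations.CyclotomicCharacterArtinNormProofs
import Literature.NumberTheory.GaloisRepresentations.LocalKroneckerWeberInertiaProofs
import HarnessLib

/-!
# The local symbol of a unit against a cyclotomic layer character: `inv_v (κₙ(u) ∪ [θ·id]) = -ψ(σ_{N u})`
# (Kato, LNM 1553, Ch. II Lemma 1.4.5 levelwise; Serre XIV §1 Prop. 3 + `ε_p ∘ Art_v = N_{K_v/ℚ_p}`)

Let `K` be a number field, `v ∣ p` a finite place, `F = K_v`, `ψ : Γ_K ↠ ℤ/n` a global cyclic character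
(`ker ψ = Gal(K̄/L)`) which FACTORS THROUGH THE `p`-ADIC CYCLOTOMIC CHARACTER `ε_p : Γ_K → ℤ_pˣ`
(`ε_p σ = ε_p τ → ψ σ = ψ τ`; e.g. the layers `ℚ(μ_{p^{k+1}})`, `log ε_p mod p^k`), and
`θ : Γ_F ↠ ℤ/n` its restriction to the decomposition group.

**Theorem** (`invLevel_cupProduct_δ₀_scalarCocycle_eq_neg_apply_of_cyclotomicCharacter_eq_norm`).  For every
UNIT `u ∈ 𝒪_Fˣ` and every `σ ∈ Γ_K` whose cyclotomic value is the norm of `u`,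
`ε_p(σ) = N_{F/ℚ_p}(u)` in `ℚ_p` (canonical `ℚ_p`-structure `LocalField.padicAlgebra`):

  `inv_n (κₙ(u) ∪ [θ·id]) = -ψ(σ)`.

So the local symbol of a unit against a cyclotomic layer character depends only on `N_{F/ℚ_p}(u)`: this is
the levelwise, integral content of Kato's Lemma 1.4.5 (`⟨exp(a), log χ_cyclo⟩ = -Tr_{F/ℚ_p}(a)`: with
`ψ_k = p^{-1} log ε_p mod p^k` one gets `inv(κ_{p^k}(exp a) ∪ [θ_k·id]) = -p^{-1} log N(exp a) = -p^{-1} Tr(a) mod p^k`)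
at completions of number fields — floor (d) of the [REC] programme of crux K★ `stmt-BirchSwinnertonDyer-22226`
(memo `Summits/…/Cruxes/StarredOptimalManinUnitFiveSeven/Lines/kato-lever-K3-programme.md` §2).

Chain: `Art_F(I_F) = 𝒪_Fˣ` gives `w ∈ I_F` with `Art_F w = u`; part III
(`invLevel_cupProduct_δ₀_scalarCocycle_eq_neg_apply_of_restrict`: `inv_n (κₙ(u) ∪ [θ·id]) = -θ(w)`);
`θ(w) = ψ(res w)`; `ε_p(res w) = ε_p^F(w)` (`cyclotomicCharacter_absGaloisRestrict`) `= N_{F/ℚ_p}(Art_F w)`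
(`cyclotomicCharacter_toAbsGalois_eq_norm_canonicalArtin`, Serre LCFT §3.1 Thm. 2 with §2.4, geometric
normalisation) `= N(u) = ε_p(σ)`, so `ψ(res w) = ψ(σ)`.

Also `…_of_mem_inertia` (the form with `w ∈ I_F`, `Art_F w = u` given).

Proof file: theorems only (no definition, no named fact, no instance; D-0026).  HONEST FRAMING: textbook local
class field theory; K★ / BSD are not proved by any of this.

## References

* K. Kato, *Lectures on the approach to Iwasawa theory for Hasse–Weil L-functions via B_dR, Part I*,
  LNM 1553 (1993), Ch. II 1.4.2, Lemma 1.4.5. [Kato1993LNM1553]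
* J.-P. Serre, *Local Fields* (1979), XIV §1 Prop. 3. [SerreLocalFields1979]
* J.-P. Serre, *Local class field theory*, Ch. VI of Cassels–Fröhlich (1967), §3.1 Thm. 2, §2.4. [CasselsFrohlichANT1967]
-/

noncomputable section

open CategoryTheory Function NumberField IsDedekindDomain Field ValuativeRel
open scoped NumberField

namespace Literature.NumberTheory.GaloisCohomology

open _root_.ContinuousCohomology
open Literature.NumberTheory.GaloisRepresentations
open Literature.NumberTheory.GaloisRepresentations.DiscreteGaloisModule
open Literature.NumberTheory.GaloisRepresentations.LocalWeilDatum
open Literature.NumberTheory.GaloisRepresentations.IsNonarchimedeanLocalField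
open Literature.NumberTheory.NumberFields
open Literature.AnabelianGeometry.AbsoluteAnabelian
open Literature.AnabelianGeometry.AbsoluteAnabelian.Prop121vii

variable {K : Type} [Field K] [NumberField K] {n : ℕ} [NeZero n]
  (L : IntermediateField K (AlgebraicClosure K)) [FiniteDimensional K L] [IsAbelianGalois K L]
  [NumberField L] (v : HeightOneSpectrum (𝓞 K)) (p : ℕ) [Fact p.Prime]

/-- **The local symbol of `Art_F w`, `w ∈ I_F`, against a cyclotomic layer character**: with `ψ : Γ_K ↠ ℤ/n`
factoring through `ε_p`, `θ = ψ ∘ res_v`, `w` in the inertia subgroup of `W_{K_v}`, `Art_v w = u`, and `σ ∈ Γ_K`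
with `ε_p(σ) = N_{K_v/ℚ_p}(u)` in `ℚ_p`: `inv_n (κₙ(u) ∪ [θ·id]) = -ψ(σ)`.
[cite: Kato1993LNM1553, Ch. II Lemma 1.4.5] [cite: SerreLocalFields1979, XIV §1 Prop. 3]
[cite: CasselsFrohlichANT1967, Ch. VI §3.1 Thm. 2 with §2.4] -/
theorem invLevel_cupProduct_δ₀_scalarCocycle_eq_neg_apply_of_mem_inertia
    (hp : valuation (v.adicCompletion K) (p : v.adicCompletion K) < 1)
    (ψ : CyclicCharacter (absoluteGaloisGroup K) n) (hker : ψ.ker = galFixing K L)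
    (hψε : ∀ σ τ : absoluteGaloisGroup K,
      GaloisRep.cyclotomicCharacter K p σ = GaloisRep.cyclotomicCharacter K p τ → ψ σ = ψ τ)
    (θ : CyclicCharacter (absoluteGaloisGroup (v.adicCompletion K)) n)
    (hθ : ∀ σ : absoluteGaloisGroup (v.adicCompletion K), ψ (absGaloisRestrict K (v.adicCompletion K) σ) = θ σ)
    (u : v.adicCompletion K) (hu : u ≠ 0) {w : WeilGroup (v.adicCompletion K)}
    (hwI : w ∈ WeilGroup.inertia (v.adicCompletion K))
    (hw : ((canonicalArtin (v.adicCompletion K) w : (v.adicCompletion K)ˣ) : v.adicCompletion K) = u)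
    (σ : absoluteGaloisGroup K)
    (hσ : haveI : CharZero (v.adicCompletion K) := charZero_adicCompletion v
      letI := LocalField.padicAlgebra (v.adicCompletion K) p hp
      (((GaloisRep.cyclotomicCharacter K p σ : ℤ_[p]ˣ) : ℤ_[p]) : ℚ_[p]) = Algebra.norm ℚ_[p] u) :
    haveI : CompactSpace (absoluteGaloisGroup (v.adicCompletion K)) := absoluteGaloisGroup_compactSpace _
    haveI : CharZero (v.adicCompletion K) := charZero_adicCompletion v
    invLevel (v.adicCompletion K) n (((mu (v.adicCompletion K) n).tateDualPairing n).cupProduct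
        ((isSES_kummer (v.adicCompletion K) n (NeZero.pos n)).δ₀ (baseUnitsInvariant (v.adicCompletion K) u hu))
        (oneCocycleClass _ (scalarCocycle θ))) = -ψ σ := by
  haveI : CompactSpace (absoluteGaloisGroup (v.adicCompletion K)) := absoluteGaloisGroup_compactSpace _
  haveI : CharZero (v.adicCompletion K) := charZero_adicCompletion v
  haveI : NeZero (p : K) := ⟨Nat.cast_ne_zero.mpr (Fact.out : p.Prime).ne_zero⟩
  letI := LocalField.padicAlgebra (v.adicCompletion K) p hp
  let ι : continuousCohomology 2 (mu (v.adicCompletion K) n).toTopRep →+ ZMod n := invLevel (v.adicCompletion K) n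
  have h : ι (((mu (v.adicCompletion K) n).tateDualPairing n).cupProduct
      ((isSES_kummer (v.adicCompletion K) n (NeZero.pos n)).δ₀ (baseUnitsInvariant (v.adicCompletion K) u hu))
      (oneCocycleClass _ (scalarCocycle θ))) = -θ (WeilGroup.toAbsGalois (v.adicCompletion K) w) :=
    invLevel_cupProduct_δ₀_scalarCocycle_eq_neg_apply_of_restrict L v ψ hker θ hθ u hu w hw
  -- `ε_p(res w) = ε_p(σ)`: both have image `N_{F/ℚ_p}(u)` in `ℚ_p`
  have hε : GaloisRep.cyclotomicCharacter K p
      (absGaloisRestrict K (v.adicCompletion K) (WeilGroup.toAbsGalois (v.adicCompletion K) w)) =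
        GaloisRep.cyclotomicCharacter K p σ := by
    refine Units.ext (PadicInt.ext ?_)
    rw [cyclotomicCharacter_absGaloisRestrict K (v.adicCompletion K) p,
      cyclotomicCharacter_toAbsGalois_eq_norm_canonicalArtin p (v.adicCompletion K) hp hwI, hw, hσ]
  change ι _ = _
  rw [h, ← hθ, hψε _ _ hε]

/-- **Kato's Lemma 1.4.5 levelwise at a completion — the local symbol of a UNIT against a cyclotomic layer
character is read off its norm.**  Let `v ∣ p` (`|p|_v < 1`), `ψ : Γ_K ↠ ℤ/n` global cyclic (`ker ψ = Gal(K̄/L)`)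
factoring through the `p`-adic cyclotomic character (`ε_p σ = ε_p τ → ψ σ = ψ τ`), `θ : Γ_{K_v} ↠ ℤ/n` its
restriction.  Then for every unit `u ∈ 𝒪_vˣ` (`|u|_v = 1`) and every `σ ∈ Γ_K` with `ε_p(σ) = N_{K_v/ℚ_p}(u)` in
`ℚ_p` (canonical `ℚ_p`-structure of `K_v`):

  `inv_n (κₙ(u) ∪ [θ·id]) = -ψ(σ)`

(`κₙ(u) ∈ H¹(Γ_{K_v}, μₙ)` the Kummer class, `inv_n` THE residue map of `K_v`).  With `n = p^k` and
`ψ = p^{-1}·log ε_p mod p^k` this reads `inv(κ_{p^k}(u) ∪ log χ_cyclo) ≡ -p^{-1} Tr_{K_v/ℚ_p}(log u)`, the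
`𝔾_m` explicit reciprocity law that Kato's Lemma 1.4.5 quotes as "well known in local class field theory".
Chain: `Art_v(I) = 𝒪_vˣ` (`IsLocalArtinMap.image_inertia`) and `…_of_mem_inertia`.
[cite: Kato1993LNM1553, Ch. II Lemma 1.4.5] [cite: SerreLocalFields1979, XIV §1 Prop. 3]
[cite: CasselsFrohlichANT1967, Ch. VI §3.1 Thm. 2 with §2.4] -/
theorem invLevel_cupProduct_δ₀_scalarCocycle_eq_neg_apply_of_cyclotomicCharacter_eq_norm
    (hp : valuation (v.adicCompletion K) (p : v.adicCompletion K) < 1)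
    (ψ : CyclicCharacter (absoluteGaloisGroup K) n) (hker : ψ.ker = galFixing K L)
    (hψε : ∀ σ τ : absoluteGaloisGroup K,
      GaloisRep.cyclotomicCharacter K p σ = GaloisRep.cyclotomicCharacter K p τ → ψ σ = ψ τ)
    (θ : CyclicCharacter (absoluteGaloisGroup (v.adicCompletion K)) n)
    (hθ : ∀ σ : absoluteGaloisGroup (v.adicCompletion K), ψ (absGaloisRestrict K (v.adicCompletion K) σ) = θ σ)
    (u : v.adicCompletion K) (hu : u ≠ 0) (hu1 : valuation (v.adicCompletion K) u = 1)
    (σ : absoluteGaloisGroup K)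
    (hσ : haveI : CharZero (v.adicCompletion K) := charZero_adicCompletion v
      letI := LocalField.padicAlgebra (v.adicCompletion K) p hp
      (((GaloisRep.cyclotomicCharacter K p σ : ℤ_[p]ˣ) : ℤ_[p]) : ℚ_[p]) = Algebra.norm ℚ_[p] u) :
    haveI : CompactSpace (absoluteGaloisGroup (v.adicCompletion K)) := absoluteGaloisGroup_compactSpace _
    haveI : CharZero (v.adicCompletion K) := charZero_adicCompletion v
    invLevel (v.adicCompletion K) n (((mu (v.adicCompletion K) n).tateDualPairing n).cupProduct
        ((isSES_kummer (v.adicCompletion K) n (NeZero.pos n)).δ₀ (baseUnitsInvariant (v.adicCompletion K) u hu))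
        (oneCocycleClass _ (scalarCocycle θ))) = -ψ σ := by
  haveI : CharZero (v.adicCompletion K) := charZero_adicCompletion v
  -- a `w ∈ I` with `Art_v w = u` (`Art_v(I) = 𝒪_vˣ`)
  have hmem : Units.mk0 u hu ∈ (WeilGroup.inertia (v.adicCompletion K)).map (canonicalArtin (v.adicCompletion K)) := by
    rw [(isLocalArtinMap_canonicalArtin_holds (v.adicCompletion K)).image_inertia, Valuation.mem_unitGroup_iff]
    exact hu1
  obtain ⟨w, hwI, hw⟩ := Subgroup.mem_map.mp hmem
  exact invLevel_cupProduct_δ₀_scalarCocycle_eq_neg_apply_of_mem_inertia L v p hp ψ hker hψε θ hθ u hu hwI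
    (by rw [hw]; rfl) σ hσ

end Literature.NumberTheory.GaloisCohomology

end
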